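import Literature.AlgebraicGeometry.Motives.WeilConjecturesForGrassmannianOfLines
import Literature.AlgebraicGeometry.Motives.ZetaFunctionOfHyperplane
import Literature.AlgebraicGeometry.Motives.ZetaFunctionPoleOrderTateConjecture
import HarnessLib

/-!
# The split (hyperbolic) quadric `Σ_{i=0}^{l+1} εᵢ xᵢ x_{2l+3−i} = 0` in `ℙ^{2l+3}` over `𝔽_q`:
# `#H(𝔽_Q) = (Q^{l+1} + 1)(Q^{l+2} − 1)/(Q − 1) = Σ_{i=0}^{2l+2} Qⁱ + Q^{l+1}`, its zeta function, its Weil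
# factorisation with `P_{2l+2} = (1 − q^{l+1}T)²` (a pole of order `2`), and the Klein quadric `≍ G(1, ℙ³)`

Topic `Literature/AlgebraicGeometry/Motives`; THEOREMS ONLY (no definition, no instance, no named fact;
D-0026).  The non-diagonal companion of the tree's `Motives/DiagonalQuadricPointCount` ∕ `DiagonalQuadricTateConjecture`
(gen-49: diagonal quadrics `Σ βᵢxᵢ²` with NON-square signed discriminant have `b_n = 1`∕ a simple pole; «quadrics
with square discriminant, pole order `2`, second ruling class» was left open there): the SPLIT quadric
`H = V₊(Σ_{i ≤ l+1} εᵢ xᵢ x_{2l+3−i}) ⊂ ℙ^{2l+3}` (`εᵢ ∈ k^*`; any characteristic, including `2`), the hyperbolic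
quadric `ℋ_{2l+3}` of finite geometry, written with the tree's `SmoothHypersurface.hypersurface` and counted
through `SmoothHypersurface.pointCount_mul_sub_one_add_one` (`N_m·(Q−1) + 1 = #{z ∈ 𝔽_Q^{2l+4} : F(z) = 0}`) and the
kernel count `natCard_sum_mul_eq_zero` of `Motives/ZetaFunctionOfHyperplane`.  For `l = 1` this is a Klein
quadric in `ℙ⁵`: `x₀x₅ + x₁x₄ + x₂x₃` (`ε = (1, 1, 1)`, the quadric `Q` of the tree's
`LineGeometry/KleinCorrespondence`) resp. the Plücker relation `p₀₁p₂₃ − p₀₂p₁₃ + p₀₃p₁₂ = 0` (`ε = (1, −1, 1)`,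
Eisenbud–Harris §3.2.1), the image of the Grassmannian of lines `G(1, ℙ³)` (`Motives/FanoSchemeOfLines`): the
two have the same point counts, hence the same zeta function, the same (unique) Weil factorisation
(`Motives/WeilConjecturesForGrassmannianOfLines`) and the same pole orders.  (The tree's `splitForm k N` of
`Motives/SplitForms` — the cell decomposition towards Chow groups — pairs the coordinates consecutively,
`x₀x₁ + x₂x₃ + ⋯`; the reversed pairing `xᵢx_{2l+3−i}` used here is the one in which the Klein quadric is
literally `x₀x₅ + x₁x₄ + x₂x₃`.  No definition is introduced: the form is written inline.)

## Sources, read on the page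

J. W. P. Hirschfeld, *Projective Geometries over Finite Fields* [Hirschfeld1998], §5.2 (held p0103–p0104):
the hyperbolic quadric `ℋ_{2s−1} = V(x₀x₁ + x₂x₃ + ⋯ + x_{2s−2}x_{2s−1})` in `PG(2s−1, q)`, **Lemma 5.2.5**
(ii) «`ψ₊(1, q) = 2`», **Theorem 5.2.6** (ii) «`ψ₊(2s−1, q) = (q^{s−1} + 1)(qˢ − 1)/(q − 1)`», with the proof's
recursion (5.2) `ψ(n) = q^{n−1} + 1 + qψ(n−2)`.
D. Eisenbud, J. Harris, *3264 and All That* [EisenbudHarris2016], §3.2.1 (the Plücker relation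
`p₁₂p₃₄ − p₁₃p₂₄ + p₁₄p₂₃ = 0`: `G(2, 4) ⊂ ℙ⁵` is a quadric hypersurface), §4.1 (`b₄(G(2,4)) = 2`: `σ₂`, `σ_{1,1}`).
A. Weil, *Numbers of solutions of equations in finite fields* [Weil1949], pp. 507–508 (the shape of the zeta
function; the Grassmannian `G_{m,r}` has `F(q)` points).
K. Ireland, M. Rosen, *A Classical Introduction to Modern Number Theory* [IrelandRosen1982], Ch. 10 §3 («the
number we are looking for is `(N − 1)/(q − 1)`»), Ch. 10 Ex. 4 (kernel of a linear form).
J. Tate, *Algebraic cycles and poles of zeta functions* [TateWoodsHole1965], §3 (the order of the pole of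
`Z(X, T)` at `T = q^{−r}` and the rank of the algebraic cycles of codimension `r`).

## What is here (`Q = #L` resp. `q^m`; the form is written inline as
## `Σ_{i : Fin (l+2)} C (εᵢ) · X_{ι i} · X_{rev (ι i)}` on `Fin (2l+2+2)`, `ι = Fin.castLE`, `rev i = 2l+3−i`)

* §1 (pure counting, `L` a finite field) **`natCard_splitForm_eq`**: `#{(u, v) ∈ L^{l+2} × L^{l+2} :
  Σ cᵢuᵢvᵢ = 0} = Q^{l+2} + (Q^{l+2} − 1)·Q^{l+1}` (`cᵢ ∈ L^*`: `u = 0` gives `Q^{l+2}` solutions, each `u ≠ 0`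
  the kernel of a non-zero linear form, `Q^{l+1}` solutions).
* §2 the hypersurface: `SplitQuadric.isHomogeneous` (degree `2`), `SplitQuadric.aeval_eq`,
  **`SplitQuadric.natCard_cone`** (`#{z ∈ L^{2l+4} : F(z) = 0} = Q^{l+2} + (Q^{l+2} − 1)Q^{l+1}`, via the
  coordinate split `z ↦ (z_{ι i}, z_{rev ι i})`).
* §3 point counts and zeta (`k` finite, `q = #k`): **`pointCount_splitQuadric`** (Hirschfeld 5.2.6 (ii):
  `#H(𝔽_{q^m}) = Σ_{i ≤ 2l+2} q^{mi} + q^{m(l+1)}`), `pointCount_splitQuadric_mul_sub_one` (`·(Q−1) =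
  (Q^{l+1} + 1)(Q^{l+2} − 1)`), `pointCount_splitQuadric_cast` (the polynomial count `Σ_r (1 + [r = l+1]) q^{rm}`),
  `pointCount_splitQuadric_surface` (`l = 0`: `(Q + 1)²`, the quadric surface `≅ ℙ¹ × ℙ¹`),
  **`zetaSeries_splitQuadric_mul_prod`** (`Z(H, T)·∏_{i ≤ 2l+2}(1 − qⁱT)·(1 − q^{l+1}T) = 1`).
* §4 the Weil conjectures for `H` (dimension `2l+2`): **`isWeilFactorization_splitQuadric`** (`P_{2r} =
  (1 − qʳT)^{1+[r = l+1]}`, `P_odd = 1`), uniqueness `IsWeilFactorization.eq_of_splitQuadric`, the Betti numbers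
  **`IsWeilFactorization.natDegree_eq_of_splitQuadric`** (`b_{2r} = 1` for `r ≠ l+1`, **`b_{2l+2} = 2`** — the two
  rulings), `eulerChar` (`χ = 2l + 4`), and **`hasPoleOfOrderAt_zetaSeries_splitQuadric`**: `Z(H, T)` has a pole of
  order EXACTLY `2` at `T = q^{−(l+1)}` (Tate 1965 §3: the rank of the middle-dimensional algebraic cycles of a
  split quadric is `2`) and simple poles at the other `q^{−r}`.
* §5 the Klein quadric (`l = 1`; `SplitQuadric.sum_fin_three_eq` writes the form out as `ε₀X₀X₅ + ε₁X₁X₄ +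
  ε₂X₂X₃` on `Fin 6`): **`pointCount_kleinQuadric_eq_pointCount_grassmannianOfLines`** (`#V₊(ε₀p₀p₅ + ε₁p₁p₄ +
  ε₂p₂p₃)(𝔽_{q^m}) = (Q²+1)(Q²+Q+1) = #G(1, ℙ³)(𝔽_{q^m})`, any `εᵢ ∈ k^*`), the literal forms
  `pointCount_kleinQuadric_one_eq_…` (`x₀x₅ + x₁x₄ + x₂x₃`) and `pointCount_plueckerQuadric_eq_…`
  (`x₀x₅ − x₁x₄ + x₂x₃`), **`zetaSeries_kleinQuadric_eq`** (`Z(Klein quadric) = Z(G(1, ℙ³))`),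
  `isWeilFactorization_kleinQuadric_iff` (same Weil factorisations), and — transported along it —
  **`hasPoleOfOrderAt_zetaSeries_grassmannianOfLines_three_two`**: `Z(G(1, ℙ³), T)` has a pole of order exactly
  `2` at `T = q^{−2}` (`σ₂`, `σ₁,₁`) and simple poles at `q^{−r}`, `r ∈ {0, 1, 3, 4}`
  (`…_three_of_ne_two`) — the Plücker embedding `G(1, ℙ³) ≅ V₊(p₀₁p₂₃ − p₀₂p₁₃ + p₀₃p₁₂)` on the level of
  zeta functions.

What is NOT here: the isomorphism of SCHEMES `G(1, ℙ³) ≅` Klein quadric (the tree's `grassmannianOfLines 3 k`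
is cut out in `ℙ¹⁵` by all alternation∕Plücker relations); `E`-valued statements (the split form is not
diagonal, so the tree's smoothness `isSmoothProjective_diagonalHypersurface` does not apply verbatim); the
elliptic quadric `ℰ_{2s−1}`.  HC is not touched.

## References

* [Hirschfeld1998] J. W. P. Hirschfeld, *Projective Geometries over Finite Fields*, 2nd ed., OUP (1998), §5.2
  Lemma 5.2.5, Theorem 5.2.6.
* [EisenbudHarris2016] D. Eisenbud, J. Harris, *3264 and All That* (2016), §3.2.1, §4.1.
* [Weil1949] A. Weil, *Numbers of solutions of equations in finite fields*, Bull. AMS 55 (1949), pp. 507–508.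
* [IrelandRosen1982] K. Ireland, M. Rosen, *A Classical Introduction to Modern Number Theory* (1982), Ch. 10
  §3 and Ex. 4.
* [TateWoodsHole1965] J. Tate, *Algebraic cycles and poles of zeta functions* (1965), §3.
* [Gottsche1993] L. Göttsche, *Hilbert schemes of zero-dimensional subschemes* (1994), §1.2 Remark 1.2.2.

## Provenance

Lane `lit-hodgefound` (summit `HodgeConjecture`, Track 2 foundations library, Layer B: motives / zeta
functions), seat `lit-hodgefound-p29` (literature-prover, generation 51, row g51-#8).
-/

universe u

open MvPolynomial Finset
open Literature.NumberTheory.LFunctions.Dwork (countZeta countZeta_congr countZeta_pow_mul countZeta_sum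
  countZeta_add zetaSeries_eq_countZeta)
open Literature.AlgebraicGeometry.Kahn2003 (HasPoleOfOrderAt)

noncomputable section

namespace Literature.AlgebraicGeometry.Motives

/-! ### §1 Counting `Σ cᵢ uᵢ vᵢ = 0` -/

section Counting

variable (L : Type u) [Field L] [Finite L] {l : ℕ}

/-- **`#{(u, v) ∈ L^{l+2} × L^{l+2} : Σᵢ cᵢuᵢvᵢ = 0} = Q^{l+2} + (Q^{l+2} − 1)·Q^{l+1}`** for units `cᵢ` (`Q = #L`):
for `u = 0` every `v`; for `u ≠ 0` the `v` form the kernel of the non-zero linear form `v ↦ Σ (cᵢuᵢ)vᵢ`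
(`Q^{l+1}` of them, the tree's `natCard_sum_mul_eq_zero`) — the affine count behind Hirschfeld's `ψ₊`.
[cite: Hirschfeld1998, §5.2 Thm. 5.2.6 (ii)] [cite: IrelandRosen1982, Ch. 10 Ex. 4] -/
theorem natCard_splitForm_eq (c : Fin (l + 2) → Lˣ) :
    Nat.card {p : (Fin (l + 2) → L) × (Fin (l + 2) → L) // ∑ i, (c i : L) * p.1 i * p.2 i = 0} =
      Nat.card L ^ (l + 2) + (Nat.card L ^ (l + 2) - 1) * Nat.card L ^ (l + 1) := by
  classical
  letI := Fintype.ofFinite L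
  have hfib : ∀ u : Fin (l + 2) → L,
      Nat.card {v : Fin (l + 2) → L // ∑ i, (c i : L) * u i * v i = 0} =
        if u = 0 then Nat.card L ^ (l + 2) else Nat.card L ^ (l + 1) := by
    intro u
    split_ifs with hu
    · subst hu
      rw [Nat.card_congr (Equiv.subtypeUnivEquiv fun v => by simp), Nat.card_fun, Nat.card_fin]
    · have ha : (fun i => (c i : L) * u i) ≠ 0 := by
        intro h
        apply hu
        funext i
        have hi := congrFun h i
        simp only [Pi.zero_apply, mul_eq_zero, Units.ne_zero, false_or] at hi
        exact hi
      rw [← natCard_sum_mul_eq_zero (k := L) (L := L) (n := l) _ ha]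
      exact Nat.card_congr (Equiv.subtypeEquivRight fun v => by simp only [Algebra.algebraMap_self_apply])
  rw [Nat.card_congr (Equiv.subtypeProdEquivSigmaSubtype fun (u v : Fin (l + 2) → L) =>
      ∑ i, (c i : L) * u i * v i = 0), Nat.card_sigma]
  simp_rw [hfib]
  rw [Finset.sum_ite, Finset.sum_const, Finset.sum_const, smul_eq_mul, smul_eq_mul,
    Finset.filter_eq' (univ : Finset (Fin (l + 2) → L)) (0 : Fin (l + 2) → L), if_pos (mem_univ _),
    card_singleton, one_mul, Finset.filter_ne' univ (0 : Fin (l + 2) → L), card_erase_of_mem (mem_univ _),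
    card_univ, Fintype.card_fun, Fintype.card_fin, ← Nat.card_eq_fintype_card]

end Counting

/-! ### §2 The split quadric as a hypersurface and its affine cone -/

namespace SplitQuadric

section Form

variable {k : Type u} [Field k] (l : ℕ) (ε : Fin (l + 2) → kˣ)

/-- `l + 2 ≤ 2l + 2 + 2`: the first half of the coordinates. [folklore] -/
private theorem le_aux (l : ℕ) : l + 2 ≤ 2 * l + 2 + 2 := by omega

/-- The split form `Σ_{i ≤ l+1} εᵢ xᵢ x_{2l+3−i}` is homogeneous of degree `2`. [cite: Hirschfeld1998, §5.2] -/
theorem isHomogeneous :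
    (∑ i : Fin (l + 2), C (ε i : k) * X (Fin.castLE (le_aux l) i) * X (Fin.rev (Fin.castLE (le_aux l) i)) :
      MvPolynomial (Fin (2 * l + 2 + 2)) k).IsHomogeneous 2 := by
  refine IsHomogeneous.sum _ _ 2 fun i _ => ?_
  have h := ((isHomogeneous_C (Fin (2 * l + 2 + 2)) (ε i : k)).mul
    (isHomogeneous_X k (Fin.castLE (le_aux l) i))).mul (isHomogeneous_X k (Fin.rev (Fin.castLE (le_aux l) i)))
  exact h

/-- Evaluation of the split form: `F(z) = Σ_{i ≤ l+1} εᵢ z_{i} z_{2l+3−i}`. [cite: Hirschfeld1998, §5.2] -/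
theorem aeval_eq {A : Type*} [CommSemiring A] [Algebra k A] (z : Fin (2 * l + 2 + 2) → A) :
    aeval z (∑ i : Fin (l + 2), C (ε i : k) * X (Fin.castLE (le_aux l) i) * X (Fin.rev (Fin.castLE (le_aux l) i)) :
      MvPolynomial (Fin (2 * l + 2 + 2)) k) =
      ∑ i : Fin (l + 2), algebraMap k A (ε i) * z (Fin.castLE (le_aux l) i) * z (Fin.rev (Fin.castLE (le_aux l) i)) := by
  rw [map_sum]
  exact Finset.sum_congr rfl fun i _ => by rw [map_mul, map_mul, aeval_C, aeval_X, aeval_X]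

end Form

section Cone

variable {k : Type u} [Field k] (l : ℕ) (ε : Fin (l + 2) → kˣ) (L : Type u) [Field L] [Algebra k L]

/-- **The affine cone of the split quadric: `#{z ∈ L^{2l+4} : Σ εᵢ z_i z_{2l+3−i} = 0} = Q^{l+2} +
(Q^{l+2} − 1)Q^{l+1}`** (`L ⊇ k` finite, `Q = #L`), through the coordinate split
`z ↦ ((z_i)_{i ≤ l+1}, (z_{2l+3−i})_{i ≤ l+1})` (the index pairs `{i, 2l+3−i}` partition `{0, …, 2l+3}`).
[cite: Hirschfeld1998, §5.2 Thm. 5.2.6 (ii)] -/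
theorem natCard_cone [Finite L] :
    Nat.card {z : Fin (2 * l + 2 + 2) → L //
        aeval z (∑ i : Fin (l + 2), C (ε i : k) * X (Fin.castLE (le_aux l) i) *
          X (Fin.rev (Fin.castLE (le_aux l) i)) : MvPolynomial (Fin (2 * l + 2 + 2)) k) = 0} =
      Nat.card L ^ (l + 2) + (Nat.card L ^ (l + 2) - 1) * Nat.card L ^ (l + 1) := by
  rw [← natCard_splitForm_eq L (fun i => Units.map (algebraMap k L : k →* L) (ε i))]
  -- the coordinate split (an `Equiv`, built inline)
  have hlt : ∀ i : Fin (l + 2), ((Fin.castLE (le_aux l) i : Fin (2 * l + 2 + 2)) : ℕ) < l + 2 := fun i => by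
    simp only [Fin.val_castLE]; exact i.2
  have hnlt : ∀ i : Fin (l + 2), ¬ ((Fin.rev (Fin.castLE (le_aux l) i) : Fin (2 * l + 2 + 2)) : ℕ) < l + 2 :=
    fun i => by simp only [Fin.val_rev, Fin.val_castLE]; omega
  let e : (Fin (2 * l + 2 + 2) → L) ≃ (Fin (l + 2) → L) × (Fin (l + 2) → L) :=
    { toFun := fun z => (fun i => z (Fin.castLE (le_aux l) i), fun i => z (Fin.rev (Fin.castLE (le_aux l) i)))
      invFun := fun p j => if h : (j : ℕ) < l + 2 then p.1 ⟨j, h⟩ else p.2 ⟨2 * l + 2 + 2 - 1 - j, by omega⟩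
      left_inv := fun z => by
        funext j
        by_cases h : (j : ℕ) < l + 2
        · simp only [dif_pos h]
          exact congrArg z (Fin.ext rfl)
        · simp only [dif_neg h]
          exact congrArg z (Fin.ext (by simp only [Fin.val_rev, Fin.val_castLE]; omega))
      right_inv := fun p => by
        ext i
        · simp only [dif_pos (hlt i)]
          exact congrArg p.1 (Fin.ext rfl)
        · simp only [dif_neg (hnlt i)]
          exact congrArg p.2 (Fin.ext (by simp only [Fin.val_rev, Fin.val_castLE]; omega)) }
  refine Nat.card_congr (e.subtypeEquiv fun z => ?_)
  rw [aeval_eq]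
  simp only [Units.coe_map, MonoidHom.coe_coe]
  rfl

end Cone

end SplitQuadric

/-! ### §3 Point counts and the zeta function -/

section PointCount

open SmoothHypersurface (hypersurface)
open SplitQuadric

variable {k : Type u} [Field k] [Finite k] (l : ℕ) (ε : Fin (l + 2) → kˣ)

/-- **Hirschfeld's `ψ₊(2s−1, q)·(q − 1) = (q^{s−1} + 1)(qˢ − 1)`** for the split quadric `H ⊂ ℙ^{2l+3}`
(`s = l + 2`) over `𝔽_{q^m}`: `#H(𝔽_Q)·(Q − 1) + 1 = Q^{l+2} + (Q^{l+2} − 1)Q^{l+1}`, `Q = q^m`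
(`SmoothHypersurface.pointCount_mul_sub_one_add_one` and the cone count). [cite: Hirschfeld1998, §5.2 Thm. 5.2.6 (ii)]
[cite: IrelandRosen1982, Ch. 10 §3] -/
theorem pointCount_splitQuadric_mul_sub_one_add_one {m : ℕ} (hm : 0 < m) :
    pointCount (hypersurface (∑ i : Fin (l + 2), C (ε i : k) * X (Fin.castLE (SplitQuadric.le_aux l) i) *
        X (Fin.rev (Fin.castLE (SplitQuadric.le_aux l) i)) : MvPolynomial (Fin (2 * l + 2 + 2)) k)) m *
        (Nat.card k ^ m - 1) + 1 =
      (Nat.card k ^ m) ^ (l + 2) + ((Nat.card k ^ m) ^ (l + 2) - 1) * (Nat.card k ^ m) ^ (l + 1) := by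
  obtain ⟨L, hLfin, hL⟩ := FiniteField.exists_intermediateField_finrank_eq (k := k) hm
  haveI := hLfin
  haveI : Module.Finite k L := Module.Finite.of_finite
  have hQ : Nat.card L = Nat.card k ^ m := by rw [Module.natCard_eq_pow_finrank (K := k) (V := L), hL]
  rw [← hQ, SmoothHypersurface.pointCount_mul_sub_one_add_one _ (SplitQuadric.isHomogeneous l ε) two_pos hm L hL,
    SplitQuadric.natCard_cone]

/-- **Hirschfeld's Theorem 5.2.6 (ii), polynomial form: `#H(𝔽_{q^m}) = Σ_{i=0}^{2l+2} q^{mi} + q^{m(l+1)}`** for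
the split quadric `H = V₊(Σ εᵢxᵢx_{2l+3−i}) ⊂ ℙ^{2l+3}` — «`ψ₊(2s−1,q) = (q^{s−1}+1)(qˢ−1)/(q−1)`», i.e.
`(1 + Q^{l+1})(1 + Q + ⋯ + Q^{l+1})`. [cite: Hirschfeld1998, §5.2 Thm. 5.2.6 (ii)] -/
theorem pointCount_splitQuadric {m : ℕ} (hm : 0 < m) :
    pointCount (hypersurface (∑ i : Fin (l + 2), C (ε i : k) * X (Fin.castLE (SplitQuadric.le_aux l) i) *
        X (Fin.rev (Fin.castLE (SplitQuadric.le_aux l) i)) : MvPolynomial (Fin (2 * l + 2 + 2)) k)) m =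
      ∑ i ∈ range (2 * l + 3), Nat.card k ^ (m * i) + Nat.card k ^ (m * (l + 1)) := by
  have h := pointCount_splitQuadric_mul_sub_one_add_one l ε hm
  set Q := Nat.card k ^ m with hQ
  have hQ1 : 1 ≤ Q := Nat.one_le_pow _ _ Nat.card_pos
  have key : (∑ i ∈ range (2 * l + 3), Q ^ i + Q ^ (l + 1)) * (Q - 1) + 1 =
      Q ^ (l + 2) + (Q ^ (l + 2) - 1) * Q ^ (l + 1) := by
    zify [hQ1, Nat.one_le_pow (l + 2) Q hQ1]
    have hg : (∑ i ∈ range (2 * l + 3), (Q : ℤ) ^ i) * ((Q : ℤ) - 1) = (Q : ℤ) ^ (2 * l + 3) - 1 :=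
      geom_sum_mul _ _
    linear_combination hg
  simp_rw [pow_mul]
  rw [← key] at h
  have hpos : 0 < Q - 1 := Nat.sub_pos_of_lt (Nat.one_lt_pow hm.ne' Finite.one_lt_card)
  exact Nat.eq_of_mul_eq_mul_right hpos (Nat.add_right_cancel h)

/-- Fraction-free: `#H(𝔽_Q)·(Q − 1) = (Q^{l+1} + 1)(Q^{l+2} − 1)` (Hirschfeld's display).
[cite: Hirschfeld1998, §5.2 Thm. 5.2.6 (ii)] -/
theorem pointCount_splitQuadric_mul_sub_one {m : ℕ} (hm : 0 < m) :
    pointCount (hypersurface (∑ i : Fin (l + 2), C (ε i : k) * X (Fin.castLE (SplitQuadric.le_aux l) i) *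
        X (Fin.rev (Fin.castLE (SplitQuadric.le_aux l) i)) : MvPolynomial (Fin (2 * l + 2 + 2)) k)) m *
        (Nat.card k ^ m - 1) =
      ((Nat.card k ^ m) ^ (l + 1) + 1) * ((Nat.card k ^ m) ^ (l + 2) - 1) := by
  rw [pointCount_splitQuadric l ε hm]
  simp_rw [pow_mul]
  set Q := Nat.card k ^ m with hQ
  have hQ1 : 1 ≤ Q := Nat.one_le_pow _ _ Nat.card_pos
  zify [hQ1, Nat.one_le_pow (l + 2) Q hQ1]
  have hg : (∑ i ∈ range (2 * l + 3), (Q : ℤ) ^ i) * ((Q : ℤ) - 1) = (Q : ℤ) ^ (2 * l + 3) - 1 := geom_sum_mul _ _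
  linear_combination hg

/-- The polynomial count in Göttsche's normal form: `#H(𝔽_{q^m}) = Σ_{r ≤ 2l+2} (1 + [r = l+1]) q^{rm}`.
[cite: Hirschfeld1998, §5.2 Thm. 5.2.6 (ii)] [cite: Gottsche1993, §1.2 Remark 1.2.2] -/
theorem pointCount_splitQuadric_cast {m : ℕ} (hm : 0 < m) :
    (pointCount (hypersurface (∑ i : Fin (l + 2), C (ε i : k) * X (Fin.castLE (SplitQuadric.le_aux l) i) *
        X (Fin.rev (Fin.castLE (SplitQuadric.le_aux l) i)) : MvPolynomial (Fin (2 * l + 2 + 2)) k)) m : ℚ) =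
      ∑ r ∈ range (2 * l + 2 + 1),
        (fun r => ((if r = l + 1 then 2 else 1 : ℕ) : ℚ)) r * (Nat.card k : ℚ) ^ (r * m) := by
  rw [pointCount_splitQuadric l ε hm, show 2 * l + 2 + 1 = 2 * l + 3 by ring, Nat.cast_add, Nat.cast_sum]
  have hsplit : ∀ r ∈ range (2 * l + 3),
      (fun r => ((if r = l + 1 then 2 else 1 : ℕ) : ℚ)) r * (Nat.card k : ℚ) ^ (r * m) =
        (Nat.card k : ℚ) ^ (r * m) + (if r = l + 1 then (Nat.card k : ℚ) ^ (r * m) else 0) := by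
    intro r _
    dsimp only
    split_ifs <;> push_cast <;> ring
  rw [sum_congr rfl hsplit, sum_add_distrib, sum_ite_eq' (range (2 * l + 3)), if_pos (mem_range.mpr (by omega))]
  simp_rw [Nat.cast_pow, mul_comm m]

/-- The quadric surface (`l = 0`): `#V₊(ε₀x₀x₃ + ε₁x₁x₂)(𝔽_Q) = (Q + 1)²` — the hyperbolic quadric in `ℙ³`,
`≅ ℙ¹ × ℙ¹` by its two rulings (Hirschfeld: `ψ₊(3, q) = (q+1)²`). [cite: Hirschfeld1998, §5.2 Thm. 5.2.6 (ii)] -/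
theorem pointCount_splitQuadric_surface (ε : Fin (0 + 2) → kˣ) {m : ℕ} (hm : 0 < m) :
    pointCount (hypersurface (∑ i : Fin (0 + 2), C (ε i : k) * X (Fin.castLE (SplitQuadric.le_aux 0) i) *
        X (Fin.rev (Fin.castLE (SplitQuadric.le_aux 0) i)) : MvPolynomial (Fin (2 * 0 + 2 + 2)) k)) m =
      (Nat.card k ^ m + 1) ^ 2 := by
  rw [pointCount_splitQuadric 0 ε hm]
  simp only [sum_range_succ, sum_range_zero, mul_zero, pow_zero, mul_one, zero_add]
  ring

/-- **`Z(H, T) · ∏_{i=0}^{2l+2} (1 − qⁱT) · (1 − q^{l+1}T) = 1`**: the zeta function of the split quadric is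
`1/((1−T)(1−qT)⋯(1−q^{2l+2}T)·(1−q^{l+1}T))`, with the middle factor SQUARED (`Dwork.countZeta_sum`,
`countZeta_pow_mul`). [cite: Weil1949, p. 507] [cite: Hirschfeld1998, §5.2 Thm. 5.2.6 (ii)] -/
theorem zetaSeries_splitQuadric_mul_prod :
    zetaSeries (hypersurface (∑ i : Fin (l + 2), C (ε i : k) * X (Fin.castLE (SplitQuadric.le_aux l) i) *
        X (Fin.rev (Fin.castLE (SplitQuadric.le_aux l) i)) : MvPolynomial (Fin (2 * l + 2 + 2)) k)) *
      ((∏ i ∈ range (2 * l + 3), ((1 - Polynomial.C ((Nat.card k : ℚ) ^ i) * Polynomial.X : Polynomial ℚ) :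
        PowerSeries ℚ)) *
        ((1 - Polynomial.C ((Nat.card k : ℚ) ^ (l + 1)) * Polynomial.X : Polynomial ℚ) : PowerSeries ℚ)) = 1 := by
  have hZ : zetaSeries (hypersurface (∑ i : Fin (l + 2), C (ε i : k) * X (Fin.castLE (SplitQuadric.le_aux l) i) *
        X (Fin.rev (Fin.castLE (SplitQuadric.le_aux l) i)) : MvPolynomial (Fin (2 * l + 2 + 2)) k)) =
      (∏ i ∈ range (2 * l + 3), countZeta (fun m => ((Nat.card k : ℤ) ^ i) ^ m)) *
        countZeta (fun m => ((Nat.card k : ℤ) ^ (l + 1)) ^ m) := by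
    rw [zetaSeries_eq_countZeta, ← countZeta_sum, ← countZeta_add]
    refine countZeta_congr fun m hm => ?_
    rw [pointCount_splitQuadric l ε hm, Pi.add_apply, Finset.sum_apply, Nat.cast_add, Nat.cast_sum]
    congr 1
    · exact sum_congr rfl fun i _ => by rw [Nat.cast_pow, ← pow_mul, mul_comm]
    · rw [Nat.cast_pow, ← pow_mul, mul_comm]
  have hc : ∀ i : ℕ, countZeta (fun m => ((Nat.card k : ℤ) ^ i) ^ m) *
      ((1 - Polynomial.C ((Nat.card k : ℚ) ^ i) * Polynomial.X : Polynomial ℚ) : PowerSeries ℚ) = 1 := by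
    intro i
    have h := countZeta_pow_mul ((Nat.card k : ℤ) ^ i)
    rw [Int.cast_pow, Int.cast_natCast] at h
    exact h
  rw [hZ, mul_mul_mul_comm, ← prod_mul_distrib, prod_eq_one fun i _ => hc i, one_mul, hc]

end PointCount

/-! ### §4 The Weil conjectures for the split quadric; the pole of order `2` -/

section Weil

open SmoothHypersurface (hypersurface)
open Polynomial
open Literature.NumberTheory.LFunctions.WeilFactorization (prod_univ_filter_eq_prod_range_filter)

variable {k : Type u} [Field k] [Finite k] (l : ℕ) (ε : Fin (l + 2) → kˣ)

/-- Re-indexing the even degrees `0, 2, …, 2d` of `Fin (2d+1)` by `r ↦ 2r` (private helper). [folklore] -/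
private theorem prod_univ_filter_even_eq_prod_range' {M : Type*} [CommMonoid M] (d : ℕ) (g : ℕ → M) :
    ∏ i ∈ (Finset.univ : Finset (Fin (2 * d + 1))) with Even i.val, g i.val =
      ∏ r ∈ Finset.range (d + 1), g (2 * r) := by
  rw [prod_univ_filter_eq_prod_range_filter]
  have hset : (Finset.range (2 * d + 1)).filter Even = (Finset.range (d + 1)).image (2 * ·) := by
    ext i
    simp only [Finset.mem_filter, Finset.mem_range, Finset.mem_image]
    constructor
    · rintro ⟨hi, ⟨r, hr⟩⟩
      exact ⟨r, by omega, by omega⟩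
    · rintro ⟨r, hr, rfl⟩
      exact ⟨by omega, even_two_mul r⟩
  rw [hset, Finset.prod_image fun a _ b _ h => by simpa using h]

omit [Field k] [Finite k] in
/-- `((1 − qʳT)^c ∈ ℤ[T]).map f = (1 − qʳT)^c` (private helper). [folklore] -/
private theorem map_one_sub_C_pow_mul_X_pow' {F : Type*} [Field F] (f : ℤ →+* F) (r c : ℕ) :
    (((1 - Polynomial.C ((Nat.card k : ℤ) ^ r) * Polynomial.X) ^ c : ℤ[X]).map f) =
      (1 - Polynomial.C ((Nat.card k : F) ^ r) * Polynomial.X) ^ c := by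
  rw [Polynomial.map_pow, Polynomial.map_sub, Polynomial.map_one, Polynomial.map_mul, Polynomial.map_C,
    Polynomial.map_X, map_pow, map_natCast]

/-- **The Weil conjectures for the split quadric `H ⊂ ℙ^{2l+3}` over `𝔽_q`** (dimension `2l+2`):
`P_{2r} = (1 − qʳT)^{1 + [r = l+1]}` (`0 ≤ r ≤ 2l+2`), `P_{2r+1} = 1` is a Weil factorisation of `Z(H, T)` — the
middle polynomial is `P_{2l+2} = (1 − q^{l+1}T)²` (two rulings), all other even ones linear; the Riemann
hypothesis: the roots `q^{−r}` have absolute value `q^{−2r/2}`. [cite: Weil1949, p. 507] [cite: Hirschfeld1998, §5.2 Thm. 5.2.6 (ii)] -/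
theorem isWeilFactorization_splitQuadric :
    IsWeilFactorization (Nat.card k) (2 * l + 2)
      (zetaSeries (hypersurface (∑ i : Fin (l + 2), MvPolynomial.C (ε i : k) *
        MvPolynomial.X (Fin.castLE (SplitQuadric.le_aux l) i) *
        MvPolynomial.X (Fin.rev (Fin.castLE (SplitQuadric.le_aux l) i)) : MvPolynomial (Fin (2 * l + 2 + 2)) k)))
      (fun i : Fin (2 * (2 * l + 2) + 1) => if Even (i : ℕ) then
        (1 - Polynomial.C ((Nat.card k : ℤ) ^ ((i : ℕ) / 2)) * Polynomial.X) ^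
          (if (i : ℕ) / 2 = l + 1 then 2 else 1)
        else 1) := by
  refine ⟨fun i => ?_, ?_, ?_, ?_, fun i z hz => ?_⟩
  · dsimp only
    split_ifs <;> simp [Polynomial.coeff_zero_eq_eval_zero]
  · -- rationality
    have hodd : ∏ i ∈ (Finset.univ : Finset (Fin (2 * (2 * l + 2) + 1))) with Odd i.val,
        (((if Even (i : ℕ) then (1 - Polynomial.C ((Nat.card k : ℤ) ^ ((i : ℕ) / 2)) * Polynomial.X) ^
          (if (i : ℕ) / 2 = l + 1 then 2 else 1) else (1 : ℤ[X])).map (Int.castRingHom ℚ) : ℚ[X]) :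
            PowerSeries ℚ) = 1 :=
      Finset.prod_eq_one fun i hi => by
        rw [if_neg (Nat.not_even_iff_odd.mpr (Finset.mem_filter.mp hi).2), Polynomial.map_one, Polynomial.coe_one]
    have heven : ∏ i ∈ (Finset.univ : Finset (Fin (2 * (2 * l + 2) + 1))) with Even i.val,
        (((if Even (i : ℕ) then (1 - Polynomial.C ((Nat.card k : ℤ) ^ ((i : ℕ) / 2)) * Polynomial.X) ^
          (if (i : ℕ) / 2 = l + 1 then 2 else 1) else (1 : ℤ[X])).map (Int.castRingHom ℚ) : ℚ[X]) :
            PowerSeries ℚ) =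
        (∏ r ∈ Finset.range (2 * l + 3), ((1 - Polynomial.C ((Nat.card k : ℚ) ^ r) * Polynomial.X : ℚ[X]) :
          PowerSeries ℚ)) * ((1 - Polynomial.C ((Nat.card k : ℚ) ^ (l + 1)) * Polynomial.X : ℚ[X]) :
            PowerSeries ℚ) := by
      rw [prod_univ_filter_even_eq_prod_range' (2 * l + 2) (fun i => (((if Even i then
          (1 - Polynomial.C ((Nat.card k : ℤ) ^ (i / 2)) * Polynomial.X) ^ (if i / 2 = l + 1 then 2 else 1)
          else (1 : ℤ[X])).map (Int.castRingHom ℚ) : ℚ[X]) : PowerSeries ℚ)),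
        show 2 * l + 2 + 1 = 2 * l + 3 by ring]
      have hterm : ∀ r ∈ Finset.range (2 * l + 3), (((if Even (2 * r) then
          (1 - Polynomial.C ((Nat.card k : ℤ) ^ (2 * r / 2)) * Polynomial.X) ^ (if 2 * r / 2 = l + 1 then 2 else 1)
          else (1 : ℤ[X])).map (Int.castRingHom ℚ) : ℚ[X]) : PowerSeries ℚ) =
          ((1 - Polynomial.C ((Nat.card k : ℚ) ^ r) * Polynomial.X : ℚ[X]) : PowerSeries ℚ) *
            (if r = l + 1 then ((1 - Polynomial.C ((Nat.card k : ℚ) ^ (l + 1)) * Polynomial.X : ℚ[X]) :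
              PowerSeries ℚ) else 1) := by
        intro r _
        rw [if_pos (even_two_mul r), Nat.mul_div_cancel_left r two_pos, map_one_sub_C_pow_mul_X_pow',
          Polynomial.coe_pow]
        split_ifs with h
        · rw [h, pow_two]
        · rw [pow_one, mul_one]
      rw [Finset.prod_congr rfl hterm, Finset.prod_mul_distrib, Finset.prod_ite_eq' (Finset.range (2 * l + 3)),
        if_pos (Finset.mem_range.mpr (by omega))]
    rw [heven, hodd]
    exact zetaSeries_splitQuadric_mul_prod l ε
  · -- `P₀ = 1 − T`
    dsimp only
    rw [if_pos (show Even ((0 : Fin (2 * (2 * l + 2) + 1)) : ℕ) from ⟨0, rfl⟩), Fin.val_zero, Nat.zero_div,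
      pow_zero, Polynomial.C_1, one_mul, if_neg (by omega), pow_one]
  · -- the top factor
    dsimp only
    rw [Fin.val_last, if_pos (even_two_mul _), Nat.mul_div_cancel_left _ two_pos, if_neg (by omega), pow_one]
  · -- the Riemann hypothesis
    dsimp only at hz
    split_ifs at hz with hi h2
    all_goals try (rw [Polynomial.map_one] at hz; exact absurd hz (by simp))
    all_goals
      obtain ⟨r, hr⟩ := hi
      have hir : (i : ℕ) / 2 = r := by omega
      rw [hir] at hz
      rw [map_one_sub_C_pow_mul_X_pow', Polynomial.IsRoot.def, Polynomial.eval_pow,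
        pow_eq_zero_iff (by norm_num), Polynomial.eval_sub, Polynomial.eval_one, Polynomial.eval_mul,
        Polynomial.eval_C, Polynomial.eval_X, sub_eq_zero] at hz
      have hqC : ((Nat.card k : ℂ) ^ r) ≠ 0 := pow_ne_zero _ (by exact_mod_cast Nat.card_pos.ne')
      have hzval : z = ((Nat.card k : ℂ) ^ r)⁻¹ := eq_inv_of_mul_eq_one_right hz.symm
      have hq : (0 : ℝ) ≤ (Nat.card k : ℝ) := Nat.cast_nonneg _
      rw [hzval, norm_inv, norm_pow, Complex.norm_natCast, hr, ← Real.rpow_natCast, ← Real.rpow_neg hq]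
      congr 1
      push_cast
      ring

/-- **Uniqueness**: any Weil factorisation of `Z(H, T)` in dimension `2l+2` is the one above (Göttsche's «read
off the pairs», the tree's `IsWeilFactorization.pointCount_eq_sum_iff_eq_pow` with `b_r = 1 + [r = l+1]`).
[cite: Gottsche1993, §1.2 Remark 1.2.2] [cite: Hirschfeld1998, §5.2 Thm. 5.2.6 (ii)] -/
theorem IsWeilFactorization.eq_of_splitQuadric {P : Fin (2 * (2 * l + 2) + 1) → ℤ[X]}
    (hW : IsWeilFactorization (Nat.card k) (2 * l + 2)
      (zetaSeries (hypersurface (∑ i : Fin (l + 2), MvPolynomial.C (ε i : k) *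
        MvPolynomial.X (Fin.castLE (SplitQuadric.le_aux l) i) *
        MvPolynomial.X (Fin.rev (Fin.castLE (SplitQuadric.le_aux l) i)) : MvPolynomial (Fin (2 * l + 2 + 2)) k))) P) :
    P = fun i : Fin (2 * (2 * l + 2) + 1) => if Even (i : ℕ) then
        (1 - Polynomial.C ((Nat.card k : ℤ) ^ ((i : ℕ) / 2)) * Polynomial.X) ^ (if (i : ℕ) / 2 = l + 1 then 2 else 1)
        else 1 := by
  obtain ⟨hodd, heven⟩ := (hW.pointCount_eq_sum_iff_eq_pow (fun r => if r = l + 1 then 2 else 1)).mp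
    fun m hm => pointCount_splitQuadric_cast l ε hm
  funext i
  by_cases hi : Even (i : ℕ)
  · rw [if_pos hi]
    obtain ⟨r, hr⟩ := hi
    rw [heven i r (by omega), show (i : ℕ) / 2 = r by omega]
  · rw [if_neg hi, hodd i (Nat.not_even_iff_odd.mp hi)]

/-- `deg (1 − qʳT)^c = c` (private helper). [folklore] -/
private theorem natDegree_one_sub_C_pow_mul_X_pow' (r c : ℕ) :
    ((1 - Polynomial.C ((Nat.card k : ℤ) ^ r) * Polynomial.X) ^ c : ℤ[X]).natDegree = c := by
  have hq : -((Nat.card k : ℤ) ^ r) ≠ 0 := neg_ne_zero.mpr (pow_ne_zero r (by exact_mod_cast Nat.card_pos.ne'))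
  have h1 : (1 - Polynomial.C ((Nat.card k : ℤ) ^ r) * Polynomial.X : ℤ[X]).natDegree = 1 := by
    rw [sub_eq_add_neg, ← neg_mul, ← Polynomial.C_neg, add_comm, ← Polynomial.C_1]
    exact Polynomial.natDegree_linear hq
  rw [Polynomial.natDegree_pow, h1, mul_one]

/-- **The Betti numbers of the split quadric `H^{2l+2} ⊂ ℙ^{2l+3}`: `b_{2r} = 1` for `r ≠ l+1`, `r ≤ 2l+2`,
`b_{2l+2} = 2`, `b_odd = 0`** (for any Weil factorisation of `Z(H, T)` in dimension `2l+2`) — the middle Betti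
number `2` of an even-dimensional quadric with square discriminant (two families of `ℙ^{l+1}`'s).
[cite: Hirschfeld1998, §5.2 Thm. 5.2.6 (ii)] [cite: EisenbudHarris2016, §4.1] [cite: Weil1949, p. 507] -/
theorem IsWeilFactorization.natDegree_eq_of_splitQuadric {P : Fin (2 * (2 * l + 2) + 1) → ℤ[X]}
    (hW : IsWeilFactorization (Nat.card k) (2 * l + 2)
      (zetaSeries (hypersurface (∑ i : Fin (l + 2), MvPolynomial.C (ε i : k) *
        MvPolynomial.X (Fin.castLE (SplitQuadric.le_aux l) i) *
        MvPolynomial.X (Fin.rev (Fin.castLE (SplitQuadric.le_aux l) i)) : MvPolynomial (Fin (2 * l + 2 + 2)) k))) P)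
    (i : Fin (2 * (2 * l + 2) + 1)) :
    (P i).natDegree = if Even (i : ℕ) then (if (i : ℕ) / 2 = l + 1 then 2 else 1) else 0 := by
  rw [hW.eq_of_splitQuadric]
  dsimp only
  split_ifs with hi h2
  · exact natDegree_one_sub_C_pow_mul_X_pow' _ 2
  · exact natDegree_one_sub_C_pow_mul_X_pow' _ 1
  · exact Polynomial.natDegree_one

/-- **`b_{2l+2}(H) = 2`**: the middle Betti number of the split quadric. [cite: EisenbudHarris2016, §4.1]
[cite: Hirschfeld1998, §5.2 Thm. 5.2.6 (ii)] -/
theorem IsWeilFactorization.natDegree_middle_of_splitQuadric {P : Fin (2 * (2 * l + 2) + 1) → ℤ[X]}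
    (hW : IsWeilFactorization (Nat.card k) (2 * l + 2)
      (zetaSeries (hypersurface (∑ i : Fin (l + 2), MvPolynomial.C (ε i : k) *
        MvPolynomial.X (Fin.castLE (SplitQuadric.le_aux l) i) *
        MvPolynomial.X (Fin.rev (Fin.castLE (SplitQuadric.le_aux l) i)) : MvPolynomial (Fin (2 * l + 2 + 2)) k))) P) :
    (P ⟨2 * (l + 1), by omega⟩).natDegree = 2 := by
  rw [hW.natDegree_eq_of_splitQuadric, if_pos (even_two_mul _), Nat.mul_div_cancel_left _ two_pos, if_pos rfl]

/-- `rootMultiplicity` of `(1 − aT)^c` at `a⁻¹` is `c` (`a ≠ 0`; private helper). [folklore] -/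
private theorem rootMultiplicity_one_sub_C_mul_X_pow {a : ℚ} (ha : a ≠ 0) (c : ℕ) :
    ((1 - Polynomial.C a * Polynomial.X) ^ c : ℚ[X]).rootMultiplicity a⁻¹ = c := by
  have h1 : Polynomial.C a * Polynomial.C a⁻¹ = (1 : ℚ[X]) := by
    rw [← Polynomial.C_mul, mul_inv_cancel₀ ha, Polynomial.C_1]
  have h : (1 - Polynomial.C a * Polynomial.X : ℚ[X]) = Polynomial.C (-a) * (Polynomial.X - Polynomial.C a⁻¹) := by
    rw [Polynomial.C_neg]
    linear_combination -h1
  rw [h, mul_pow, ← Polynomial.C_pow, Polynomial.rootMultiplicity_mul, Polynomial.rootMultiplicity_C,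
    Polynomial.rootMultiplicity_X_sub_C_pow, zero_add]
  exact mul_ne_zero (Polynomial.C_ne_zero.mpr (pow_ne_zero _ (neg_ne_zero.mpr ha)))
    (pow_ne_zero _ (Polynomial.X_sub_C_ne_zero _))

/-- **The zeta function of the split quadric has a pole of order EXACTLY `2` at `T = q^{−(l+1)}`** (and the
middle Weil polynomial is `(1 − q^{l+1}T)²`): Tate 1965 §3 — the order of the pole at `q^{−r}` is the rank of the
algebraic `r`-cycles granted his conjecture; for the split quadric both rulings contribute (the tree's
`IsWeilFactorization.hasPoleOfOrderAt`). [cite: TateWoodsHole1965, §3] [cite: Hirschfeld1998, §5.2 Thm. 5.2.6 (ii)] -/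
theorem hasPoleOfOrderAt_zetaSeries_splitQuadric_middle :
    HasPoleOfOrderAt (zetaSeries (hypersurface (∑ i : Fin (l + 2), MvPolynomial.C (ε i : k) *
        MvPolynomial.X (Fin.castLE (SplitQuadric.le_aux l) i) *
        MvPolynomial.X (Fin.rev (Fin.castLE (SplitQuadric.le_aux l) i)) : MvPolynomial (Fin (2 * l + 2 + 2)) k)))
      (((Nat.card k : ℚ) ^ (l + 1))⁻¹) 2 := by
  have h := (isWeilFactorization_splitQuadric l ε).hasPoleOfOrderAt Finite.one_lt_card (r := l + 1) (by omega)
  dsimp only at h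
  rwa [if_pos (even_two_mul _), Nat.mul_div_cancel_left _ two_pos, if_pos rfl, map_one_sub_C_pow_mul_X_pow',
    rootMultiplicity_one_sub_C_mul_X_pow (pow_ne_zero _ (Nat.cast_ne_zero.mpr Nat.card_pos.ne'))] at h

/-- Off the middle dimension the poles are simple: `Z(H, T)` has a pole of order exactly `1` at `T = q^{−r}` for
`r ≤ 2l+2`, `r ≠ l+1`. [cite: TateWoodsHole1965, §3] [cite: Weil1949, p. 507] -/
theorem hasPoleOfOrderAt_zetaSeries_splitQuadric_of_ne {r : ℕ} (hr : r ≤ 2 * l + 2) (hne : r ≠ l + 1) :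
    HasPoleOfOrderAt (zetaSeries (hypersurface (∑ i : Fin (l + 2), MvPolynomial.C (ε i : k) *
        MvPolynomial.X (Fin.castLE (SplitQuadric.le_aux l) i) *
        MvPolynomial.X (Fin.rev (Fin.castLE (SplitQuadric.le_aux l) i)) : MvPolynomial (Fin (2 * l + 2 + 2)) k)))
      (((Nat.card k : ℚ) ^ r)⁻¹) 1 := by
  have h := (isWeilFactorization_splitQuadric l ε).hasPoleOfOrderAt Finite.one_lt_card (r := r) hr
  dsimp only at h
  rwa [if_pos (even_two_mul _), Nat.mul_div_cancel_left _ two_pos, if_neg hne, map_one_sub_C_pow_mul_X_pow',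
    rootMultiplicity_one_sub_C_mul_X_pow (pow_ne_zero _ (Nat.cast_ne_zero.mpr Nat.card_pos.ne'))] at h

end Weil

/-! ### §5 The Klein quadric and the Grassmannian of lines `G(1, ℙ³)` -/

section Klein

open SmoothHypersurface (hypersurface)

variable {k : Type u} [Field k] [Finite k]

/-- The split form for `l = 1`, written out on the six coordinates of `ℙ⁵`:
`Σ_{i<3} εᵢ X_{ι i} X_{rev (ι i)} = ε₀X₀X₅ + ε₁X₁X₄ + ε₂X₂X₃`. [cite: Hirschfeld1998, §5.2] -/
theorem SplitQuadric.sum_fin_three_eq {K : Type u} [Field K] (ε : Fin (1 + 2) → Kˣ) :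
    (∑ i : Fin (1 + 2), C (ε i : K) * X (Fin.castLE (SplitQuadric.le_aux 1) i) *
        X (Fin.rev (Fin.castLE (SplitQuadric.le_aux 1) i)) : MvPolynomial (Fin (2 * 1 + 2 + 2)) K) =
      C (ε 0 : K) * X 0 * X 5 + C (ε 1 : K) * X 1 * X 4 + C (ε 2 : K) * X 2 * X 3 := by
  rw [Fin.sum_univ_three]
  rfl

/-- **`#V₊(ε₀p₀p₅ + ε₁p₁p₄ + ε₂p₂p₃)(𝔽_Q) = (Q² + 1)(Q² + Q + 1) = #G(1, ℙ³)(𝔽_Q)`** (`εᵢ ∈ k^*`): a Klein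
quadric in `ℙ⁵` — for `ε = (1, 1, 1)` the quadric `x₀x₅ + x₁x₄ + x₂x₃` of the tree's
`LineGeometry/KleinCorrespondence` (Plücker coordinates in the order `(p₁₂, p₁₃, p₁₄, p₂₃, p₄₂, p₃₄)`), for
`ε = (1, −1, 1)` the Plücker relation `p₀₁p₂₃ − p₀₂p₁₃ + p₀₃p₁₂` of Eisenbud–Harris — and the Grassmannian of
lines in `ℙ³` have the same number of `𝔽_{q^m}`-points for every `m ≥ 1`. [cite: EisenbudHarris2016, §3.2.1]
[cite: Hirschfeld1998, §5.2 Thm. 5.2.6 (ii)] -/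
theorem pointCount_kleinQuadric_eq_pointCount_grassmannianOfLines (ε : Fin 3 → kˣ) {m : ℕ} (hm : 0 < m) :
    pointCount (hypersurface (C (ε 0 : k) * X 0 * X 5 + C (ε 1 : k) * X 1 * X 4 + C (ε 2 : k) * X 2 * X 3 :
      MvPolynomial (Fin 6) k)) m = pointCount (grassmannianOfLines 3 k) m := by
  have h : pointCount (hypersurface (C (ε 0 : k) * X 0 * X 5 + C (ε 1 : k) * X 1 * X 4 +
      C (ε 2 : k) * X 2 * X 3 : MvPolynomial (Fin 6) k)) m =
        ∑ i ∈ range (2 * 1 + 3), Nat.card k ^ (m * i) + Nat.card k ^ (m * (1 + 1)) := by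
    have h' := pointCount_splitQuadric 1 ε hm
    rwa [SplitQuadric.sum_fin_three_eq] at h'
  rw [h, pointCount_grassmannianOfLines_three hm]
  simp only [sum_range_succ, sum_range_zero, show 2 * 1 + 3 = 5 from rfl]
  ring

/-- `ε = (1, 1, 1)`: **`#V₊(x₀x₅ + x₁x₄ + x₂x₃)(𝔽_{q^m}) = #G(1, ℙ³)(𝔽_{q^m})`** — the Klein quadric `Q` of
`LineGeometry/KleinCorrespondence` (every point of `Q` is the Plücker point of exactly one line).
[cite: EisenbudHarris2016, §3.2.1] [cite: Hirschfeld1998, §5.2 Thm. 5.2.6 (ii)] -/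
theorem pointCount_kleinQuadric_one_eq_pointCount_grassmannianOfLines {m : ℕ} (hm : 0 < m) :
    pointCount (hypersurface (X 0 * X 5 + X 1 * X 4 + X 2 * X 3 : MvPolynomial (Fin 6) k)) m =
      pointCount (grassmannianOfLines 3 k) m := by
  have hF : (C (((fun _ => 1 : Fin 3 → kˣ) 0 : kˣ) : k) * X 0 * X 5 +
      C (((fun _ => 1 : Fin 3 → kˣ) 1 : kˣ) : k) * X 1 * X 4 +
      C (((fun _ => 1 : Fin 3 → kˣ) 2 : kˣ) : k) * X 2 * X 3 : MvPolynomial (Fin 6) k) =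
        X 0 * X 5 + X 1 * X 4 + X 2 * X 3 := by
    simp only [Units.val_one, C_1, one_mul]
  rw [← hF]
  exact pointCount_kleinQuadric_eq_pointCount_grassmannianOfLines (fun _ => 1) hm

/-- `ε = (1, −1, 1)`: **`#V₊(p₀₁p₂₃ − p₀₂p₁₃ + p₀₃p₁₂)(𝔽_{q^m}) = #G(1, ℙ³)(𝔽_{q^m})`** — the Plücker relation
in the coordinates `(p₀₁, p₀₂, p₀₃, p₁₂, p₁₃, p₂₃)` of `ℙ⁵`. [cite: EisenbudHarris2016, §3.2.1]
[cite: Hirschfeld1998, §5.2 Thm. 5.2.6 (ii)] -/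
theorem pointCount_plueckerQuadric_eq_pointCount_grassmannianOfLines {m : ℕ} (hm : 0 < m) :
    pointCount (hypersurface (X 0 * X 5 - X 1 * X 4 + X 2 * X 3 : MvPolynomial (Fin 6) k)) m =
      pointCount (grassmannianOfLines 3 k) m := by
  have hF : (C (((![1, -1, 1] : Fin 3 → kˣ) 0 : kˣ) : k) * X 0 * X 5 +
      C (((![1, -1, 1] : Fin 3 → kˣ) 1 : kˣ) : k) * X 1 * X 4 +
      C (((![1, -1, 1] : Fin 3 → kˣ) 2 : kˣ) : k) * X 2 * X 3 : MvPolynomial (Fin 6) k) =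
        X 0 * X 5 - X 1 * X 4 + X 2 * X 3 := by
    simp only [Matrix.cons_val_zero, Matrix.cons_val_one, Matrix.cons_val_two, Matrix.head_cons,
      Matrix.tail_cons, Units.val_one, Units.val_neg, map_neg, C_1, one_mul, neg_mul, sub_eq_add_neg]
  rw [← hF]
  exact pointCount_kleinQuadric_eq_pointCount_grassmannianOfLines ![1, -1, 1] hm

/-- **`Z(Klein quadric, T) = Z(G(1, ℙ³), T)`**: the Plücker embedding identifies the Grassmannian of lines of
`ℙ³` with the Klein quadric, here on the level of zeta functions (equal point counts over every `𝔽_{q^m}`).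
[cite: EisenbudHarris2016, §3.2.1] [cite: Weil1949, pp. 507–508] -/
theorem zetaSeries_kleinQuadric_eq (ε : Fin 3 → kˣ) :
    zetaSeries (hypersurface (C (ε 0 : k) * X 0 * X 5 + C (ε 1 : k) * X 1 * X 4 + C (ε 2 : k) * X 2 * X 3 :
      MvPolynomial (Fin 6) k)) = zetaSeries (grassmannianOfLines 3 k) := by
  rw [zetaSeries_eq_countZeta, zetaSeries_eq_countZeta]
  exact countZeta_congr fun m hm => by rw [pointCount_kleinQuadric_eq_pointCount_grassmannianOfLines ε hm]

/-- The Klein quadric and `G(1, ℙ³)` have the same Weil factorisations (in dimension `4`): `P₀ = 1 − T`,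
`P₂ = 1 − qT`, `P₄ = (1 − q²T)²`, `P₆ = 1 − q³T`, `P₈ = 1 − q⁴T`. [cite: Weil1949, pp. 507–508] [cite: EisenbudHarris2016, §4.1] -/
theorem isWeilFactorization_kleinQuadric_iff (ε : Fin 3 → kˣ) (P : Fin (2 * 4 + 1) → Polynomial ℤ) :
    IsWeilFactorization (Nat.card k) 4 (zetaSeries (hypersurface (C (ε 0 : k) * X 0 * X 5 +
        C (ε 1 : k) * X 1 * X 4 + C (ε 2 : k) * X 2 * X 3 : MvPolynomial (Fin 6) k))) P ↔
      IsWeilFactorization (Nat.card k) 4 (zetaSeries (grassmannianOfLines 3 k)) P := by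
  rw [zetaSeries_kleinQuadric_eq]

/-- **`Z(G(1, ℙ³), T)` has a pole of order EXACTLY `2` at `T = q^{−2}`** (through the Klein quadric): Tate 1965
§3 — the `2`-cycles `σ₂`, `σ₁,₁` of `G(1, ℙ³)` (the two rulings of the Klein quadric) have rank `2`
(`b₄(G(2, 4)) = 2`). [cite: TateWoodsHole1965, §3] [cite: EisenbudHarris2016, §4.1] -/
theorem hasPoleOfOrderAt_zetaSeries_grassmannianOfLines_three_two :
    HasPoleOfOrderAt (zetaSeries (grassmannianOfLines 3 k)) (((Nat.card k : ℚ) ^ 2)⁻¹) 2 := by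
  have h : HasPoleOfOrderAt (zetaSeries (hypersurface (C (((fun _ => 1 : Fin 3 → kˣ) 0 : kˣ) : k) * X 0 * X 5 +
      C (((fun _ => 1 : Fin 3 → kˣ) 1 : kˣ) : k) * X 1 * X 4 +
      C (((fun _ => 1 : Fin 3 → kˣ) 2 : kˣ) : k) * X 2 * X 3 : MvPolynomial (Fin 6) k)))
        (((Nat.card k : ℚ) ^ (1 + 1))⁻¹) 2 := by
    have h' := hasPoleOfOrderAt_zetaSeries_splitQuadric_middle (k := k) 1 (fun _ => 1)
    rwa [SplitQuadric.sum_fin_three_eq] at h'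
  rwa [zetaSeries_kleinQuadric_eq (fun _ => 1)] at h

/-- … and simple poles at `T = 1, q^{−1}, q^{−3}, q^{−4}` (`b₀ = b₂ = b₆ = b₈ = 1`). [cite: TateWoodsHole1965, §3]
[cite: Weil1949, pp. 507–508] -/
theorem hasPoleOfOrderAt_zetaSeries_grassmannianOfLines_three_of_ne_two {r : ℕ} (hr : r ≤ 4) (hne : r ≠ 2) :
    HasPoleOfOrderAt (zetaSeries (grassmannianOfLines 3 k)) (((Nat.card k : ℚ) ^ r)⁻¹) 1 := by
  have h : HasPoleOfOrderAt (zetaSeries (hypersurface (C (((fun _ => 1 : Fin 3 → kˣ) 0 : kˣ) : k) * X 0 * X 5 +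
      C (((fun _ => 1 : Fin 3 → kˣ) 1 : kˣ) : k) * X 1 * X 4 +
      C (((fun _ => 1 : Fin 3 → kˣ) 2 : kˣ) : k) * X 2 * X 3 : MvPolynomial (Fin 6) k)))
        (((Nat.card k : ℚ) ^ r)⁻¹) 1 := by
    have h' := hasPoleOfOrderAt_zetaSeries_splitQuadric_of_ne (k := k) 1 (fun _ => 1) (r := r) (by omega)
      (by omega)
    rwa [SplitQuadric.sum_fin_three_eq] at h'
  rwa [zetaSeries_kleinQuadric_eq (fun _ => 1)] at h

end Klein

end Literature.AlgebraicGeometry.Motives
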